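import Mathlib.NumberTheory.Bertrand
import Mathlib.Data.Nat.Log
import Literature.Computability.Complexity.BooleanFourier
import Literature.Computability.MetaComplexity.NWStrings
import HarnessLib

/-!
# A polynomial-time list-decodable binary code (Hirahara 2018, Thm. 4.7), I: the code and the inner Hadamard layer

Topic `Literature/Computability/MetaComplexity`. First file of the vendoring of the list-decodable
error-correcting code used by Hirahara's non-black-box reduction (S. Hirahara, *Non-black-box
worst-case to average-case reductions within NP*, FOCS 2018 / ECCC TR18-138 rev. 1):

> **Thm. 4.7** (= Thm. III.8 of the proceedings version; "see, e.g., [Sud97] and [Vad12, Problem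
> 5.2]"). *For any `n ∈ ℕ` and `ε > 0` there exists a function `Enc_{n,ε} : {0,1}ⁿ → {0,1}^{2^ℓ}`
> with `ℓ = O(log(n/ε))` that is a `(poly(1/ε), 1/2 - ε)`-list-decodable error-correcting code.
> Moreover, `Enc_{n,ε}` and its list decoder `Dec_{n,ε}` are computable in time `poly(n, 1/ε)`.*

and of its consequence for time-bounded Kolmogorov complexity, **Cor. 4.8** (`K_{t'}(x) ≤
K_{t,ε}(Enc(x)) + O(log(n/ε))`), the form in which the code enters Lemma 4.9 / Cor. 4.12 / Thm. 4.21
(the tree's named fact `Hirahara2018_gapMINKTSearch_of_AvgDeltaP` and, through it,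
`Hirahara2018_gapMINKT_mem_PromiseP`, `GapMINKT.lean`).

The code is the standard concatenation of a Reed–Solomon code with the Hadamard code
(Arora–Barak 2009, §19.3–19.4; Sudan 1997): for `ε = 1/e` and `n = |x|`,

* `b := ⌊log₂(e⁴(n+1))⌋ + 13`, `q :=` the least prime `> 2^{b-1}` (so `q ≤ 2^b` by Bertrand's
  postulate and `q > 2¹¹ e⁴ (n+1)`);
* the message `x ∈ {0,1}ⁿ` is read as the polynomial `p_x = Σᵢ xᵢ Xⁱ ∈ 𝔽_q[X]` of degree `< n`
  (bits as coefficients — the rate is immaterial for Thm. 4.7);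
* the codeword has length `2^{2b}`; position `p = α·2^b + y` (`α, y < 2^b`) carries the Hadamard
  bit `⟨bin_b(p_x(α mod q)), bin_b(y)⟩ mod 2` of the Reed–Solomon symbol at `β = α mod q`
  (every `β < q` occurs once or twice since `2^{b-1} < q ≤ 2^b`; this makes the length an exact
  power of two, as Def. 4.5 of the paper wants, over a PRIME field, so that the tree's mod-`p`
  linear algebra applies to the decoder).

This file: the parameters (`LDC.bOf`, `LDC.qOf` and their inequalities), the message polynomial and
its Horner evaluation on naturals (`LDC.symb`), the Hadamard bit `LDC.hadN`, the code `LDC.enc`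
(`length_enc : |enc e x| = 2 ^ ell |x| e`, `ell = 2b`), the blockwise decomposition of the agreement
count `NWStr.agreeCount` (the convention of `NWStrings.lean`, in which the NW reconstruction delivers
its approximation of `Enc(x)`), and the two counting lemmas of the INNER decoding:

* `LDC.card_hadamard_agree_mul_sq_le` — **the Hadamard code is combinatorially list-decodable**:
  for any received block `G` and `D > 0`, the number of `v < 2^b` whose Hadamard codeword agrees with
  `G` on at least `(2^b + D)/2` of the `2^b` positions is at most `4^b / D²` (Parseval on the cube,
  `LowDegree.sum_cubeFourierCoeff_sq` of `BooleanFourier.lean`; O'Donnell 2014, §1.4; the bound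
  `1/(4η²)` familiar from Goldreich–Levin);
* `LDC.le_mul_card_goodBlocks` — **averaging**: if the total agreement is at least `(1/2 + 1/e)` of
  the length then at least a `1/(e-1)` fraction of the blocks have agreement `≥ (1/2 + 1/(2e))`.

The outer (Reed–Solomon / Sudan) layer, the decoder with `O(log(ne))` bits of advice, its
polynomial-time realisation and Cor. 4.8 are the sibling files `ListDecodableCodeSudan.lean`,
`ListDecodableCodeDecoder.lean`, `ListDecodableCodeFP.lean`, `ListDecodableCodeKt.lean`.

## Design notes

* Decoding is vendored in the ADVICE form that Kolmogorov-complexity arguments consume ("`x` is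
  the `i`-th element of the list" becomes: some `O(log(n/ε))`-bit string `adv` makes the deterministic
  polynomial-time decoder output exactly `x`), which is what Cor. 4.8 needs and which lets the
  root-finding step of Sudan's algorithm be replaced by Newton iteration from an advised simple point
  (no bivariate factorisation is formalised).
* All thresholds are kept in integer form (`2·e·agree ≥ (e+2)·length` for "agreement
  `≥ (1/2 + 1/e)`"), matching `NWStr.agreeCount`.

## References

* S. Hirahara, *Non-black-box worst-case to average-case reductions within NP*, FOCS 2018,
  247–258 (Thm. III.8, Cor. III.9); full version ECCC TR18-138 rev. 1, Thm. 4.7, Cor. 4.8 [Hirahara2018].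
* M. Sudan, *Decoding of Reed Solomon codes beyond the error-correction bound*, J. Complexity 13
  (1997) 180–193.
* S. Arora, B. Barak, *Computational Complexity: A Modern Approach*, CUP 2009, §19.3–19.4
  (Reed–Solomon, Walsh–Hadamard, concatenation; list decoding) [AroraBarakCC2009].
* R. O'Donnell, *Analysis of Boolean Functions*, CUP 2014, §1.4 (Parseval) [ODonnell2014].
* J. Bertrand / P. Chebyshev (Bertrand's postulate; Mathlib `Nat.exists_prime_lt_and_le_two_mul`).
-/

namespace Literature.Computability.MetaComplexity

open _root_.Computability Complexity Finset

namespace LDC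

/-! ### Parameters -/

/-- The block exponent `b = ⌊log₂(e⁴(n+1))⌋ + 13`: blocks and inner Hadamard codewords have length
`2^b`, the whole codeword `2^{2b}`. [cite: Hirahara2018, Thm. 4.7 (`ℓ = O(log(n/ε))`)] -/
def bOf (n e : ℕ) : ℕ := Nat.log 2 (e ^ 4 * (n + 1)) + 13

/-- The exponent `ℓ = 2b` of the codeword length `2^ℓ`. [cite: Hirahara2018, Thm. 4.7] -/
def ell (n e : ℕ) : ℕ := 2 * bOf n e

/-- `2^{11} e⁴ (n+1) < 2^{b-1}`: the field is large compared to `n` and `1/ε⁴`. [folklore] -/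
theorem lt_two_pow_bOf_sub_one (n e : ℕ) : 2 ^ 11 * (e ^ 4 * (n + 1)) < 2 ^ (bOf n e - 1) := by
  have h := Nat.lt_pow_succ_log_self (b := 2) Nat.one_lt_two (e ^ 4 * (n + 1))
  have hb : bOf n e - 1 = 11 + (Nat.log 2 (e ^ 4 * (n + 1)) + 1) := by unfold bOf; omega
  rw [hb, pow_add]
  exact Nat.mul_lt_mul_of_pos_left h (by positivity)

/-- `13 ≤ b`. [folklore] -/
theorem thirteen_le_bOf (n e : ℕ) : 13 ≤ bOf n e := Nat.le_add_left 13 _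

/-- There is a prime above `2^{b-1}`. [folklore] -/
theorem exists_prime_gt (n e : ℕ) : ∃ p, 2 ^ (bOf n e - 1) < p ∧ p.Prime := by
  obtain ⟨p, hp, hlt, -⟩ := Nat.exists_prime_lt_and_le_two_mul (2 ^ (bOf n e - 1)) (by positivity)
  exact ⟨p, hlt, hp⟩

open Classical in
/-- The field size `q`: the least prime above `2^{b-1}` (found by the decoder by trial division).
[cite: AroraBarakCC2009, §19.3 (Reed–Solomon codes over `𝔽_q`)] -/
noncomputable def qOf (n e : ℕ) : ℕ := Nat.find (exists_prime_gt n e)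

/-- `q` is prime. [folklore] -/
theorem qOf_prime (n e : ℕ) : (qOf n e).Prime := by
  classical exact (Nat.find_spec (exists_prime_gt n e)).2

/-- `2^{b-1} < q`. [folklore] -/
theorem two_pow_lt_qOf (n e : ℕ) : 2 ^ (bOf n e - 1) < qOf n e := by
  classical exact (Nat.find_spec (exists_prime_gt n e)).1

/-- `2 * 2^{b-1} = 2^b`. [folklore] -/
theorem two_mul_two_pow_sub_one (n e : ℕ) : 2 * 2 ^ (bOf n e - 1) = 2 ^ bOf n e := by
  have h13 := thirteen_le_bOf n e
  obtain ⟨c, hc⟩ : ∃ c, bOf n e = c + 1 := ⟨bOf n e - 1, by omega⟩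
  rw [hc, Nat.add_sub_cancel, pow_succ']

/-- `q ≤ 2^b` (Bertrand's postulate). [folklore] -/
theorem qOf_le_two_pow (n e : ℕ) : qOf n e ≤ 2 ^ bOf n e := by
  classical
  obtain ⟨p, hp, hlt, hle⟩ := Nat.exists_prime_lt_and_le_two_mul (2 ^ (bOf n e - 1)) (by positivity)
  have hmin : qOf n e ≤ p := Nat.find_min' (exists_prime_gt n e) ⟨hlt, hp⟩
  rw [← two_mul_two_pow_sub_one]
  exact hmin.trans hle

/-- `q` is the LEAST prime above `2^{b-1}`: no prime lies strictly between (what the trial-division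
search of the decoder relies on). [folklore] -/
theorem not_prime_of_lt_qOf (n e : ℕ) {p : ℕ} (h1 : 2 ^ (bOf n e - 1) < p) (h2 : p < qOf n e) : ¬ p.Prime := by
  classical
  intro hp
  exact absurd h2 (not_lt.2 (Nat.find_min' (exists_prime_gt n e) ⟨h1, hp⟩))

/-- `2^{11} e⁴ (n+1) < q`. [folklore] -/
theorem lt_qOf (n e : ℕ) : 2 ^ 11 * (e ^ 4 * (n + 1)) < qOf n e :=
  (lt_two_pow_bOf_sub_one n e).trans (two_pow_lt_qOf n e)

/-- `2^{11} e⁴ (n+1) < q`, multiplied out: for `e ≥ 1`, `2^{11} (n+1) ≤ 2^{11} e⁴ (n+1) < q`. [folklore] -/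
theorem lt_qOf_of_one_le {n e : ℕ} (he : 1 ≤ e) : 2 ^ 11 * (n + 1) < qOf n e := by
  refine lt_of_le_of_lt (Nat.mul_le_mul_left _ ?_) (lt_qOf n e)
  exact Nat.le_mul_of_pos_left _ (by positivity)

/-- `n < q` for `e ≥ 1` (so that polynomials of degree `< n` are determined by their values on `𝔽_q`).
[folklore] -/
theorem lt_qOf_left {n e : ℕ} (he : 1 ≤ e) : n < qOf n e := by
  have h := lt_qOf_of_one_le (n := n) he
  have : n < 2 ^ 11 * (n + 1) := by
    calc n < n + 1 := Nat.lt_succ_self n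
      _ ≤ 2 ^ 11 * (n + 1) := Nat.le_mul_of_pos_left _ (by positivity)
  exact this.trans h

/-- `2^b < 2q`. [folklore] -/
theorem two_pow_lt_two_mul_qOf (n e : ℕ) : 2 ^ bOf n e < 2 * qOf n e := by
  rw [← two_mul_two_pow_sub_one]; exact Nat.mul_lt_mul_of_pos_left (two_pow_lt_qOf n e) two_pos

/-! ### The Hadamard bit and the message polynomial -/

/-- The Hadamard (inner-product) bit `⟨bin_b(v), bin_b(y)⟩ mod 2` of two `b`-bit numbers: the parity
of the number of common `1`-bits below `b`. [cite: AroraBarakCC2009, §19.3 (Walsh–Hadamard code)] -/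
def hadN (b v y : ℕ) : Bool :=
  Nat.bodd ((univ.filter fun k : Fin b => v.testBit k && y.testBit k).card)

/-- Horner evaluation of the message polynomial `p_x = Σᵢ xᵢ Xⁱ` at `β` modulo `q`, on naturals:
the Reed–Solomon symbol of `x` at `β`. [cite: AroraBarakCC2009, §19.3 (Reed–Solomon code)] -/
def symb (q : ℕ) (x : List Bool) (β : ℕ) : ℕ :=
  x.foldr (fun bit acc => ((bif bit then 1 else 0) + β * acc) % q) 0

/-- Symbols are reduced modulo `q` (for `q > 0`; for the empty message the symbol is `0`). [folklore] -/
theorem symb_lt {q : ℕ} (hq : 0 < q) (x : List Bool) (β : ℕ) : symb q x β < q := by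
  cases x with
  | nil => exact hq
  | cons bit t => exact Nat.mod_lt _ hq

/-! ### The code -/

/-- The bit of the concatenated codeword at position `p` (block `α = p / 2^b`, inner position
`y = p mod 2^b`, Reed–Solomon position `β = α mod q`). [cite: Hirahara2018, Thm. 4.7] -/
def encBit (b q : ℕ) (x : List Bool) (p : ℕ) : Bool :=
  hadN b (symb q x ((p / 2 ^ b) % q)) (p % 2 ^ b)

/-- The concatenated Reed–Solomon–Hadamard code with explicit parameters `b, q`: the string of the
`2^b · 2^b` bits `encBit`. [cite: Hirahara2018, Thm. 4.7] -/
def encWith (b q : ℕ) (x : List Bool) : List Bool :=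
  List.ofFn fun p : Fin (2 ^ b * 2 ^ b) => encBit b q x p

/-- **`Enc_{n,ε}(x)`** for `ε = 1/e`, `n = |x|`: the code of Thm. 4.7 with the parameters `bOf`,
`qOf`. [cite: Hirahara2018, Thm. 4.7] -/
noncomputable def enc (e : ℕ) (x : List Bool) : List Bool :=
  encWith (bOf x.length e) (qOf x.length e) x

/-- Length of `encWith`. [folklore] -/
@[simp] theorem length_encWith (b q : ℕ) (x : List Bool) : (encWith b q x).length = 2 ^ b * 2 ^ b := by
  simp [encWith]

/-- **The codeword length is `2^ℓ`, `ℓ = ell |x| e = 2b`.** [cite: Hirahara2018, Thm. 4.7] -/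
theorem length_enc (e : ℕ) (x : List Bool) : (enc e x).length = 2 ^ ell x.length e := by
  rw [enc, length_encWith, ell, two_mul, pow_add]

/-- Reading a bit of `encWith`. [folklore] -/
theorem getD_encWith (b q : ℕ) (x : List Bool) {p : ℕ} (hp : p < 2 ^ b * 2 ^ b) :
    (encWith b q x).getD p false = encBit b q x p := by
  rw [encWith, List.getD_eq_getElem _ _ (by simpa using hp), List.getElem_ofFn]

/-! ### Blockwise agreement -/

/-- The agreement of block `α` of a received word `g` (positions `α·2^b + y`, `y < 2^b`) with the
Hadamard codeword of `v`. [cite: AroraBarakCC2009, §19.4 (decoding concatenated codes blockwise)] -/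
def blockAgree (b : ℕ) (g : List Bool) (α v : ℕ) : ℕ :=
  ((range (2 ^ b)).filter fun y => g.getD (α * 2 ^ b + y) false = hadN b v y).card

/-- A block agreement is at most the block length. [folklore] -/
theorem blockAgree_le (b : ℕ) (g : List Bool) (α v : ℕ) : blockAgree b g α v ≤ 2 ^ b :=
  (card_filter_le _ _).trans (card_range _).le

/-- **The total agreement with a codeword is the sum of the block agreements with its symbols**
(received word of the codeword's length, in the convention `NWStr.agreeCount received codeword`).
[cite: AroraBarakCC2009, §19.4] -/
theorem agreeCount_encWith (b q : ℕ) (x : List Bool) {g : List Bool} (hg : g.length = 2 ^ b * 2 ^ b) :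
    NWStr.agreeCount g (encWith b q x) = ∑ α ∈ range (2 ^ b), blockAgree b g α (symb q x (α % q)) := by
  unfold NWStr.agreeCount blockAgree
  rw [hg, ← card_sigma]
  -- positions `p < 2^b · 2^b` ↔ pairs `(α, y)` via `p = α·2^b + y`
  have hpos : (0 : ℕ) < 2 ^ b := by positivity
  have hlt : ∀ {α y : ℕ}, α < 2 ^ b → y < 2 ^ b → α * 2 ^ b + y < 2 ^ b * 2 ^ b := fun {α y} hα hy => by
    calc α * 2 ^ b + y < α * 2 ^ b + 2 ^ b := Nat.add_lt_add_left hy _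
      _ = (α + 1) * 2 ^ b := by ring
      _ ≤ 2 ^ b * 2 ^ b := by rw [Nat.mul_comm]; exact Nat.mul_le_mul_left _ hα
  have hdiv : ∀ {α y : ℕ}, y < 2 ^ b → (α * 2 ^ b + y) / 2 ^ b = α := fun {α y} hy => by
    rw [Nat.add_comm, Nat.add_mul_div_right _ _ hpos, Nat.div_eq_of_lt hy, Nat.zero_add]
  have hmod : ∀ {α y : ℕ}, y < 2 ^ b → (α * 2 ^ b + y) % 2 ^ b = y := fun {α y} hy => by
    rw [Nat.add_comm, Nat.add_mul_mod_self_right, Nat.mod_eq_of_lt hy]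
  symm
  refine card_nbij' (fun s => s.1 * 2 ^ b + s.2) (fun p => ⟨p / 2 ^ b, p % 2 ^ b⟩) (fun s hs => ?_) (fun p hp => ?_)
    (fun s hs => ?_) (fun p _ => Nat.div_add_mod' p (2 ^ b))
  · obtain ⟨α, y⟩ := s
    simp only [mem_coe, mem_sigma, mem_range, mem_filter] at hs
    rw [mem_coe, mem_filter, mem_range]
    refine ⟨hlt hs.1 hs.2.1, ?_⟩
    rw [getD_encWith b q x (hlt hs.1 hs.2.1), encBit, hdiv hs.2.1, hmod hs.2.1]
    exact hs.2.2
  · rw [mem_coe, mem_filter, mem_range] at hp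
    simp only [mem_coe, mem_sigma, mem_range, mem_filter]
    have hp1 : p < 2 ^ b * 2 ^ b := hp.1
    refine ⟨Nat.div_lt_of_lt_mul (by rwa [Nat.mul_comm]), Nat.mod_lt _ hpos, ?_⟩
    have h := hp.2
    rw [getD_encWith b q x hp.1, encBit] at h
    rwa [Nat.div_add_mod' p (2 ^ b)]
  · obtain ⟨α, y⟩ := s
    simp only [mem_coe, mem_sigma, mem_range, mem_filter] at hs
    simp [hdiv hs.2.1, hmod hs.2.1]

/-! ### The Hadamard code is combinatorially list-decodable (Parseval) -/

section Hadamard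

variable {b : ℕ}

/-- The point of the cube `{0,1}^b` with coordinates the low `b` bits of `y`. [folklore] -/
def cubeOf (b y : ℕ) : Fin b → Bool := fun k => y.testBit k

/-- Reading back: the number with bits `z`. [folklore] -/
def natOfCube (z : Fin b → Bool) : ℕ := bitsToNat (List.ofFn z)

/-- `natOfCube z < 2^b`. [folklore] -/
theorem natOfCube_lt (z : Fin b → Bool) : natOfCube z < 2 ^ b := by
  have h := bitsToNat_lt (List.ofFn z)
  rwa [List.length_ofFn] at h

/-- `bitsToNat` reads bits: bit `i` of the value is entry `i` of the list (the statement of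
`testBit_bitsToNat_eq_getD`, `StackWords.lean`, re-proved to keep the imports small). [folklore] -/
theorem testBit_bitsToNat' (u : List Bool) (i : ℕ) : (bitsToNat u).testBit i = u.getD i false := by
  induction u generalizing i with
  | nil => simp
  | cons c u ih =>
    cases i with
    | zero =>
      rw [bitsToNat_cons, Nat.testBit_zero]
      cases c <;> simp [Nat.add_mod]
    | succ i =>
      rw [bitsToNat_cons, Nat.testBit_succ, List.getD_cons_succ, ← ih]
      congr 1
      cases c <;> simp [Nat.add_mul_div_left]

/-- The bits of `natOfCube z` are `z`. [folklore] -/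
theorem testBit_natOfCube (z : Fin b → Bool) (k : Fin b) : (natOfCube z).testBit k = z k := by
  rw [natOfCube, testBit_bitsToNat', Kannan.getD_ofFn z k.isLt]

/-- `cubeOf ∘ natOfCube = id`. [folklore] -/
theorem cubeOf_natOfCube (z : Fin b → Bool) : cubeOf b (natOfCube z) = z :=
  funext fun k => testBit_natOfCube z k

/-- Bits above `b` of a number `< 2^b` vanish. [folklore] -/
theorem testBit_eq_false_of_lt_two_pow {y k : ℕ} (hy : y < 2 ^ b) (hk : b ≤ k) : y.testBit k = false :=
  Nat.testBit_eq_false_of_lt (lt_of_lt_of_le hy (Nat.pow_le_pow_right two_pos hk))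

/-- `natOfCube ∘ cubeOf = id` below `2^b`. [folklore] -/
theorem natOfCube_cubeOf {y : ℕ} (hy : y < 2 ^ b) : natOfCube (cubeOf b y) = y := by
  apply Nat.eq_of_testBit_eq
  intro k
  by_cases hk : k < b
  · exact testBit_natOfCube (cubeOf b y) ⟨k, hk⟩
  · rw [testBit_eq_false_of_lt_two_pow (natOfCube_lt _) (not_lt.1 hk), testBit_eq_false_of_lt_two_pow hy (not_lt.1 hk)]

/-- `cubeOf` is injective below `2^b`. [folklore] -/
theorem cubeOf_injOn {y y' : ℕ} (hy : y < 2 ^ b) (hy' : y' < 2 ^ b) (h : cubeOf b y = cubeOf b y') : y = y' := by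
  rw [← natOfCube_cubeOf hy, ← natOfCube_cubeOf hy', h]

/-- Sums over `y < 2^b` are sums over the cube. [folklore] -/
theorem sum_range_eq_sum_cube (F : ℕ → ℝ) : ∑ y ∈ range (2 ^ b), F y = ∑ z : Fin b → Bool, F (natOfCube z) := by
  refine (sum_nbij' (fun z => natOfCube z) (fun y => cubeOf b y) (fun z _ => mem_range.2 (natOfCube_lt z))
    (fun y _ => mem_univ _) (fun z _ => cubeOf_natOfCube z) (fun y hy => natOfCube_cubeOf (mem_range.1 hy))
    (fun z _ => rfl)).symm

/-- The support of the low `b` bits of `v`, an index of a Walsh character. [folklore] -/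
def suppOf (b v : ℕ) : Finset (Fin b) := univ.filter fun k => v.testBit k

/-- `suppOf` is injective below `2^b`. [folklore] -/
theorem suppOf_injOn {v v' : ℕ} (hv : v < 2 ^ b) (hv' : v' < 2 ^ b) (h : suppOf b v = suppOf b v') : v = v' := by
  refine cubeOf_injOn hv hv' (funext fun k => ?_)
  have := congrArg (fun S => decide (k ∈ S)) h
  simpa [suppOf, cubeOf] using this

/-- `(-1)^N` is the sign of the parity of `N`. [folklore] -/
theorem sgn_bodd (N : ℕ) : Literature.Probability.RandomGraphs.LowDegree.sgn (Nat.bodd N) = (-1 : ℝ) ^ N := by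
  induction N with
  | zero => simp
  | succ N ih => rw [Nat.bodd_succ, pow_succ, ← ih]; cases Nat.bodd N <;> simp

/-- **The Walsh character indexed by the support of `v` is the sign of the Hadamard bit**:
`χ_{supp v}(bits y) = (-1)^{⟨v, y⟩}`. [cite: ODonnell2014, §1.4] -/
theorem walsh_suppOf (v : ℕ) (z : Fin b → Bool) :
    Literature.Probability.RandomGraphs.LowDegree.walsh (suppOf b v) z =
      Literature.Probability.RandomGraphs.LowDegree.sgn (hadN b v (natOfCube z)) := by
  rw [Literature.Probability.RandomGraphs.LowDegree.walsh, hadN, sgn_bodd]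
  have hsgn : ∀ k ∈ suppOf b v, Literature.Probability.RandomGraphs.LowDegree.sgn (z k) = if z k = true then (-1 : ℝ) else 1 := by
    intro k _; cases z k <;> simp
  rw [prod_congr rfl hsgn, prod_ite, prod_const_one, mul_one, prod_const]
  congr 1
  refine congrArg card (Finset.ext fun k => ?_)
  simp [suppOf, testBit_natOfCube, Bool.and_eq_true]

/-- **Combinatorial list-decodability of the Hadamard code** (Parseval bound): for every received
block `G : ℕ → Bool` (read at `y < 2^b`) and every `D > 0`, the number of `v < 2^b` whose Hadamard
codeword `y ↦ ⟨v, y⟩` agrees with `G` in at least `(2^b + D)/2` positions is at most `4^b / D²`; i.e.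
at relative agreement `1/2 + η` the list has size `≤ 1/(4η²)`. Proof: the normalised correlation of
`(-1)^G` with the character of `v` is its Fourier coefficient `≥ D/2^b`, and the squares of all
coefficients sum to `1`. [cite: AroraBarakCC2009, §19.3–19.4 (list size of Walsh–Hadamard, via Parseval)]
[cite: ODonnell2014, §1.4] -/
theorem card_hadamard_agree_mul_sq_le (b : ℕ) (G : ℕ → Bool) (D : ℕ) :
    ((range (2 ^ b)).filter fun v => 2 ^ b + D ≤
        2 * ((range (2 ^ b)).filter fun y => G y = hadN b v y).card).card * D ^ 2 ≤ 4 ^ b := by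
  classical
  set g : (Fin b → Bool) → ℝ := fun z => Literature.Probability.RandomGraphs.LowDegree.sgn (G (natOfCube z)) with hg
  set L := (range (2 ^ b)).filter fun v => 2 ^ b + D ≤ 2 * ((range (2 ^ b)).filter fun y => G y = hadN b v y).card
    with hL
  have h2b : (0 : ℝ) < 2 ^ b := by positivity
  -- the correlation of block `v`: `2^b · ĝ(supp v) = 2·agree_v - 2^b`
  have hcorr : ∀ v : ℕ, (2 : ℝ) ^ b * LowDegree.cubeFourierCoeff g (suppOf b v) =
      2 * ((range (2 ^ b)).filter fun y => G y = hadN b v y).card - 2 ^ b := by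
    intro v
    rw [LowDegree.cubeFourierCoeff, mul_div_cancel₀ _ h2b.ne']
    have hterm : ∀ z : Fin b → Bool, g z * Literature.Probability.RandomGraphs.LowDegree.walsh (suppOf b v) z =
        (if G (natOfCube z) = hadN b v (natOfCube z) then (1 : ℝ) else 0) * 2 - 1 := by
      intro z
      rw [walsh_suppOf, hg]
      rcases Bool.eq_false_or_eq_true (G (natOfCube z)) with h1 | h1 <;>
        rcases Bool.eq_false_or_eq_true (hadN b v (natOfCube z)) with h2 | h2 <;>
          simp only [h1, h2, Literature.Probability.RandomGraphs.LowDegree.sgn] <;> norm_num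
    rw [sum_congr rfl fun z _ => hterm z, sum_sub_distrib, ← sum_mul, sum_const, card_univ, Fintype.card_fun,
      Fintype.card_bool, Fintype.card_fin, nsmul_eq_mul, mul_one]
    rw [← sum_range_eq_sum_cube (fun y => if G y = hadN b v y then (1 : ℝ) else 0), sum_boole]
    push_cast
    ring
  -- Parseval: the squares of all coefficients sum to `1`
  have hpars : ∑ S : Finset (Fin b), LowDegree.cubeFourierCoeff g S ^ 2 = 1 := by
    rw [LowDegree.sum_cubeFourierCoeff_sq]
    have h1 : ∀ z : Fin b → Bool, g z ^ 2 = 1 := fun z => by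
      rw [hg]; cases G (natOfCube z) <;> simp [Literature.Probability.RandomGraphs.LowDegree.sgn]
    rw [sum_congr rfl fun z _ => h1 z, sum_const, card_univ, Fintype.card_fun, Fintype.card_bool, Fintype.card_fin,
      nsmul_eq_mul, mul_one]
    push_cast
    exact div_self h2b.ne'
  -- each listed `v` has coefficient `≥ D / 2^b`
  have hbig : ∀ v ∈ L, (D : ℝ) / 2 ^ b ≤ LowDegree.cubeFourierCoeff g (suppOf b v) := by
    intro v hv
    rw [hL, mem_filter] at hv
    rw [div_le_iff₀ h2b, mul_comm]
    have h := hcorr v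
    have hv2 : ((2 ^ b + D : ℕ) : ℝ) ≤ ((2 * ((range (2 ^ b)).filter fun y => G y = hadN b v y).card : ℕ) : ℝ) := by
      exact_mod_cast hv.2
    push_cast at hv2
    linarith
  -- sum over the list, through the injection `v ↦ supp v`
  have hinj : Set.InjOn (suppOf b) L := fun v hv v' hv' h =>
    suppOf_injOn (mem_range.1 (mem_filter.1 hv).1) (mem_range.1 (mem_filter.1 hv').1) h
  have hsum : (L.card : ℝ) * ((D : ℝ) / 2 ^ b) ^ 2 ≤ 1 := by
    calc (L.card : ℝ) * ((D : ℝ) / 2 ^ b) ^ 2 = ∑ v ∈ L, ((D : ℝ) / 2 ^ b) ^ 2 := by rw [sum_const, nsmul_eq_mul]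
      _ ≤ ∑ v ∈ L, LowDegree.cubeFourierCoeff g (suppOf b v) ^ 2 :=
          sum_le_sum fun v hv => pow_le_pow_left₀ (by positivity) (hbig v hv) 2
      _ = ∑ S ∈ L.image (suppOf b), LowDegree.cubeFourierCoeff g S ^ 2 :=
          (sum_image (f := fun S => LowDegree.cubeFourierCoeff g S ^ 2) hinj).symm
      _ ≤ ∑ S, LowDegree.cubeFourierCoeff g S ^ 2 :=
          sum_le_sum_of_subset_of_nonneg (subset_univ _) fun _ _ _ => sq_nonneg _
      _ = 1 := hpars
  have h4 : (4 : ℝ) ^ b = (2 ^ b) ^ 2 := by rw [← pow_mul, mul_comm, pow_mul]; norm_num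
  have hreal : (L.card : ℝ) * (D : ℝ) ^ 2 ≤ (4 : ℝ) ^ b := by
    rw [h4]
    have := mul_le_mul_of_nonneg_right hsum (sq_nonneg ((2 : ℝ) ^ b))
    rwa [one_mul, mul_assoc, ← mul_pow, div_mul_cancel₀ _ h2b.ne'] at this
  exact_mod_cast hreal

end Hadamard

/-! ### Averaging: many blocks have large agreement -/

/-- **Averaging over blocks**: if `M` numbers `A α ≤ N` have `2e·Σ_α A α ≥ (e+2)·M·N` (total agreement
at least `(1/2 + 1/e)` of `M·N`), then the number `G` of indices with `2e·A α ≥ (e+1)·N` (agreement at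
least `1/2 + 1/(2e)`) satisfies `M ≤ (e-1)·G`. [cite: AroraBarakCC2009, §19.4 (averaging over the
blocks of a concatenated code)] -/
theorem le_mul_card_goodBlocks {M N e : ℕ} (A : ℕ → ℕ) (hA : ∀ α < M, A α ≤ N) (hN : 0 < N)
    (htot : (e + 2) * (M * N) ≤ 2 * e * ∑ α ∈ range M, A α) :
    M ≤ (e - 1) * ((range M).filter fun α => (e + 1) * N ≤ 2 * e * A α).card := by
  set Gd := (range M).filter fun α => (e + 1) * N ≤ 2 * e * A α with hGd
  set Bd := (range M).filter fun α => ¬ (e + 1) * N ≤ 2 * e * A α with hBd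
  have hsplit : ∑ α ∈ range M, 2 * e * A α = ∑ α ∈ Gd, 2 * e * A α + ∑ α ∈ Bd, 2 * e * A α :=
    (sum_filter_add_sum_filter_not (range M) _ _).symm
  have hG : ∑ α ∈ Gd, 2 * e * A α ≤ ∑ α ∈ Gd, 2 * e * N :=
    sum_le_sum fun α hα => Nat.mul_le_mul_left _ (hA α (mem_range.1 (mem_filter.1 hα).1))
  have hB : ∑ α ∈ Bd, 2 * e * A α ≤ ∑ α ∈ Bd, (e + 1) * N :=
    sum_le_sum fun α hα => (not_le.1 (mem_filter.1 hα).2).le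
  rw [sum_const, smul_eq_mul] at hG hB
  have hcard : Gd.card + Bd.card = M := by
    rw [hGd, hBd, card_filter_add_card_filter_not, card_range]
  have htot' : (e + 2) * (M * N) ≤ Gd.card * (2 * e * N) + Bd.card * ((e + 1) * N) := by
    calc (e + 2) * (M * N) ≤ 2 * e * ∑ α ∈ range M, A α := htot
      _ = ∑ α ∈ range M, 2 * e * A α := mul_sum _ _ _
      _ ≤ _ := by rw [hsplit]; exact Nat.add_le_add hG hB
  -- arithmetic over `ℤ`: with `B = M - G`, `(e+2) M N ≤ 2 e N G + (e+1) N (M - G)` gives `M N ≤ (e-1) N G`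
  have hGM : Gd.card ≤ M := by omega
  rcases Nat.eq_zero_or_pos e with he | he
  · subst he
    -- `2 M N ≤ Bd·N ≤ M N` forces `M N = 0`, hence `M = 0`
    have h0 : 2 * (M * N) ≤ M * N := by
      calc 2 * (M * N) = (0 + 2) * (M * N) := by ring
        _ ≤ Gd.card * (2 * 0 * N) + Bd.card * ((0 + 1) * N) := htot'
        _ = Bd.card * N := by ring
        _ ≤ M * N := Nat.mul_le_mul_right _ (by omega)
    have hM : M = 0 := by
      rcases Nat.eq_zero_or_pos M with h | h
      · exact h
      · have := Nat.mul_pos h hN; omega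
    simp [hM]
  · obtain ⟨e', rfl⟩ : ∃ e', e = e' + 1 := ⟨e - 1, by omega⟩
    rw [Nat.add_sub_cancel]
    have hB' : (Bd.card : ℤ) = M - Gd.card := by push_cast [← hcard]; ring
    have h1 : ((e' + 1 + 2 : ℕ) : ℤ) * (M * N) ≤ Gd.card * (2 * (e' + 1 : ℕ) * N) + Bd.card * ((e' + 1 + 1 : ℕ) * N) := by
      exact_mod_cast htot'
    rw [hB'] at h1
    push_cast at h1
    -- `M N ≤ e' N G`
    have h2 : (M : ℤ) * N ≤ e' * N * Gd.card := by nlinarith [h1]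
    have h3 : (M : ℤ) ≤ e' * Gd.card := by
      have hNz : (0 : ℤ) < N := by exact_mod_cast hN
      nlinarith [h2, hNz]
    exact_mod_cast h3

end LDC

end Literature.Computability.MetaComplexity
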